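import Mathlib.RingTheory.PowerSeries.Derivative
import Mathlib.RingTheory.PowerSeries.Binomial
import Mathlib.RingTheory.PowerSeries.Inverse
import HarnessLib

/-!
# The Wronskian step of the `λ`-descent (AN-F₂, route (RIG)): a power series `L` with
# `(1+T)·(Q·L′ − Q′·L) + a·Q·L = 0` is `c · (1+T)^{−a} · Q`
# (helper file for crux 2 `GoodLatticeBDPValue`, stmt-BirchSwinnertonDyer-19032, line `halves`, stub 3
# `stub_anDS`, piece AN-F₂ `KatzLineDescentAt` of `Cruxes/GoodLatticeBDPValue/Lines/halves_anDS_split_idea11g4.lean`;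
# seat `bsd-line-x1-p1-w3` gen 2)

Route (RIG) of AN-F₂ («different-period rigidity»: two CGLS-type frames `Q`, `L` of ONE `θ_K` at
different period pairs, read along the powers `φ₁^k` of one interpolation character, satisfy
`Q(u^k − 1) = d^k · L(u^k − 1)`, `u = φ̂₁(γ)`, `d = c^{2n₁}`) reaches the coefficient ring through a
FORMAL differential equation: the pointwise relation forces (next file) the identity
`(1+T)·(Q·L′ − Q′·L) + a·Q·L = 0` in `ℂ_p⟦T⟧` for the constant `a = −lim_j (d^{−p^j} − 1)/(u^{p^j} − 1)`.
This file solves that equation over any field `𝕜` of characteristic `0`, with no analysis: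

* §1 `natCast_add_one_mul_choose_succ`: `(n+1)·C(a, n+1) = (a − n)·C(a, n)` for the generalized
  binomial coefficients `Ring.choose` of a field of characteristic zero;
  `one_add_X_mul_derivative_binomialSeries`: `(1+T)·((1+T)^a)′ = a·(1+T)^a` for Mathlib's
  `PowerSeries.binomialSeries 𝕜 a = Σ C(a,n) T^n`; `binomialSeries_mul_binomialSeries_neg`,
  `isUnit_binomialSeries`.
* §2 `exists_eq_C_mul_of_wronskian` (ABEL'S IDENTITY, formal): if `Q ≠ 0` and `Q·M′ = Q′·M` then
  `M = c·Q` for a constant `c` (write `Q = T^n·U` with `U` a unit; then `T·G′ = n·G` for `G = M·U⁻¹`,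
  whose only solutions in characteristic `0` are `G = g_n T^n`).
* §3 `exists_eq_C_mul_binomialSeries_mul_of_ode`: `Q ≠ 0` and `(1+T)·(Q·L′ − Q′·L) + a·Q·L = 0`
  imply `L = c · (1+T)^{−a} · Q` (apply §2 to `M := (1+T)^a · L`).

Pure commutative algebra (power series over a field of characteristic `0`); no fact, no definition, no
`sorry`; nothing about BSD. References: Washington 1997 §7.1–7.2 (the algebra `Λ ⊂ 𝒪⟦T⟧`, `(1+T)^s`);
Cassels 1986 Ch. 4 (Strassmann) for the role of the identity in the rigidity argument.
-/

-- the summit namespace `Summit.BirchSwinnertonDyer.BirchSwinnertonDyer` repeats the problem name by design (D-0017)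
set_option linter.dupNamespace false
set_option autoImplicit false

noncomputable section

open scoped Classical

open PowerSeries

namespace Summit.BirchSwinnertonDyer.BirchSwinnertonDyer.Theorems.KatzLineDescent

variable {𝕜 : Type*} [Field 𝕜] [CharZero 𝕜]

/-! ## §1 The binomial series `(1+T)^a` and its logarithmic derivative -/

/-- `(n+1)·C(a, n+1) = (a − n)·C(a, n)` for the generalized binomial coefficients of a field of
characteristic zero (`n!·C(a,n)` is the falling factorial `a(a−1)⋯(a−n+1)`).
[cite: Washington1997, §7.1 (the binomial series `(1+T)^s`)] -/
theorem natCast_add_one_mul_choose_succ (a : 𝕜) (n : ℕ) :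
    ((n : 𝕜) + 1) * Ring.choose a (n + 1) = (a - n) * Ring.choose a n := by
  have h1 : ((n + 1).factorial : 𝕜) * Ring.choose a (n + 1) =
      (descPochhammer ℤ (n + 1)).smeval a := by
    rw [Ring.descPochhammer_eq_factorial_smul_choose, nsmul_eq_mul]
  have h2 : ((n.factorial : 𝕜)) * Ring.choose a n = (descPochhammer ℤ n).smeval a := by
    rw [Ring.descPochhammer_eq_factorial_smul_choose, nsmul_eq_mul]
  have h3 : (descPochhammer ℤ (n + 1)).smeval a =
      (descPochhammer ℤ n).smeval a * (a - n) := by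
    rw [descPochhammer_succ_right, Polynomial.smeval_mul, Polynomial.smeval_sub,
      Polynomial.smeval_X, Polynomial.smeval_natCast]
    simp only [pow_one, pow_zero, nsmul_eq_mul, mul_one]
  have hfac : ((n.factorial : 𝕜)) ≠ 0 := by exact_mod_cast Nat.factorial_ne_zero n
  have key : ((n.factorial : 𝕜)) * (((n : 𝕜) + 1) * Ring.choose a (n + 1)) =
      ((n.factorial : 𝕜)) * ((a - n) * Ring.choose a n) := by
    calc ((n.factorial : 𝕜)) * (((n : 𝕜) + 1) * Ring.choose a (n + 1))
        = ((n + 1).factorial : 𝕜) * Ring.choose a (n + 1) := by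
          rw [Nat.factorial_succ, Nat.cast_mul, Nat.cast_succ]; ring
      _ = (descPochhammer ℤ n).smeval a * (a - n) := by rw [h1, h3]
      _ = ((n.factorial : 𝕜)) * ((a - n) * Ring.choose a n) := by rw [← h2]; ring
  exact mul_left_cancel₀ hfac key

/-- **`(1+T)·((1+T)^a)′ = a·(1+T)^a`** for the binomial series `(1+T)^a = Σ_n C(a,n) T^n ∈ 𝕜⟦T⟧`.
[cite: Washington1997, §7.1 (the binomial series `(1+T)^s`)] -/
theorem one_add_X_mul_derivative_binomialSeries (a : 𝕜) :
    (1 + X) * d⁄dX 𝕜 (binomialSeries 𝕜 a) = C a * binomialSeries 𝕜 a := by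
  ext n
  have h2 := natCast_add_one_mul_choose_succ a n
  rw [add_mul, one_mul, map_add, coeff_C_mul, coeff_derivative, binomialSeries_coeff,
    binomialSeries_coeff, smul_eq_mul, mul_one, smul_eq_mul, mul_one]
  rcases n with _ | n
  · rw [coeff_zero_X_mul]
    push_cast at h2 ⊢
    linear_combination h2
  · rw [coeff_succ_X_mul, coeff_derivative, binomialSeries_coeff, smul_eq_mul, mul_one]
    push_cast at h2 ⊢
    linear_combination h2

/-- `(1+T)^a · (1+T)^{−a} = 1`. [cite: Washington1997, §7.1] -/
theorem binomialSeries_mul_binomialSeries_neg (a : 𝕜) :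
    binomialSeries 𝕜 a * binomialSeries 𝕜 (-a) = 1 := by
  rw [← binomialSeries_add, add_neg_cancel, binomialSeries_zero]

/-- `(1+T)^a` is a unit of `𝕜⟦T⟧`. [cite: Washington1997, §7.1] -/
theorem isUnit_binomialSeries (a : 𝕜) : IsUnit (binomialSeries 𝕜 a) :=
  isUnit_iff_exists_inv.mpr ⟨_, binomialSeries_mul_binomialSeries_neg a⟩

/-! ## §2 Abel's identity: a vanishing Wronskian with `Q ≠ 0` forces proportionality -/

/-- The only solutions of `T·G′ = n·G` in `𝕜⟦T⟧` (`char 𝕜 = 0`) are the monomials `g_n T^n`.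
[cite: Washington1997, §7.1] -/
theorem eq_monomial_of_X_mul_derivative_eq {G : PowerSeries 𝕜} {n : ℕ}
    (h : X * d⁄dX 𝕜 G = C (n : 𝕜) * G) : G = monomial n (coeff n G) := by
  ext k
  rw [coeff_monomial]
  split_ifs with hk
  · rw [hk]
  · have hk' : coeff k (X * d⁄dX 𝕜 G) = coeff k (C (n : 𝕜) * G) := by rw [h]
    rw [coeff_C_mul] at hk'
    rcases k with _ | k
    · rw [coeff_zero_X_mul] at hk'
      have hn : (n : 𝕜) ≠ 0 := by exact_mod_cast (Ne.symm hk)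
      exact (mul_eq_zero.mp hk'.symm).resolve_left hn
    · rw [coeff_succ_X_mul, coeff_derivative] at hk'
      have hne : ((k : 𝕜) + 1) - n ≠ 0 := by
        intro h0
        apply hk
        have : ((k + 1 : ℕ) : 𝕜) = (n : 𝕜) := by push_cast; exact (sub_eq_zero.mp h0)
        exact_mod_cast this
      have : (((k : 𝕜) + 1) - n) * coeff (k + 1) G = 0 := by
        linear_combination hk'
      exact (mul_eq_zero.mp this).resolve_left hne

/-- **Abel's identity (formal)**: if `Q ≠ 0` and the Wronskian `Q·M′ − Q′·M` vanishes in `𝕜⟦T⟧`, then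
`M = c·Q` for a constant `c ∈ 𝕜` (write `Q = T^n·U`, `U` a unit; `G := M·U⁻¹` satisfies `T·G′ = n·G`).
[cite: Washington1997, §7.1] -/
theorem exists_eq_C_mul_of_wronskian {Q M : PowerSeries 𝕜} (hQ : Q ≠ 0)
    (h : Q * d⁄dX 𝕜 M = d⁄dX 𝕜 Q * M) : ∃ c : 𝕜, M = C c * Q := by
  -- `Q = X^n * U` with `U` a unit
  set n := Q.order.toNat with hn
  obtain ⟨U, hU⟩ := isUnit_divided_by_X_pow_order hQ
  have hQU : Q = X ^ n * (U : PowerSeries 𝕜) := by rw [hU, hn, X_pow_order_mul_divXPowOrder]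
  -- `G := M * U⁻¹`, so `M = G * U`
  set G : PowerSeries 𝕜 := M * ↑U⁻¹ with hG
  have hMG : M = G * U := by rw [hG, Units.inv_mul_cancel_right]
  -- the equation for `G`
  have hXG : X ^ n * (X * d⁄dX 𝕜 G) = X ^ n * (C (n : 𝕜) * G) := by
    have hU2 : IsUnit ((U : PowerSeries 𝕜) * U) := (Units.isUnit U).mul (Units.isUnit U)
    -- expand both sides of `h`
    have hQ' : d⁄dX 𝕜 Q = C (n : 𝕜) * X ^ (n - 1) * (U : PowerSeries 𝕜) +
        X ^ n * d⁄dX 𝕜 (U : PowerSeries 𝕜) := by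
      rw [hQU, Derivation.leibniz, derivative_pow, derivative_X, smul_eq_mul, smul_eq_mul,
        map_natCast]
      ring
    have hM' : d⁄dX 𝕜 M = d⁄dX 𝕜 G * (U : PowerSeries 𝕜) + G * d⁄dX 𝕜 (U : PowerSeries 𝕜) := by
      rw [hMG, Derivation.leibniz, smul_eq_mul, smul_eq_mul]; ring
    rw [hQ', hM', hQU, hMG] at h
    -- `h : X^n U (G' U + G U') = (n X^(n-1) U + X^n U') (G U)`
    have key : (X ^ n * (d⁄dX 𝕜 G) - C (n : 𝕜) * X ^ (n - 1) * G) *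
        ((U : PowerSeries 𝕜) * (U : PowerSeries 𝕜)) = 0 := by
      linear_combination h
    rw [mul_eq_zero] at key
    rcases key with key | key
    · rcases Nat.eq_zero_or_pos n with h0 | hpos
      · -- n = 0
        rw [h0, pow_zero, one_mul, one_mul, Nat.cast_zero, map_zero, zero_mul]
        rw [h0, pow_zero, one_mul, Nat.cast_zero, map_zero, zero_mul, zero_mul, sub_zero] at key
        rw [key, mul_zero]
      · have hn1 : n = (n - 1) + 1 := (Nat.sub_add_cancel hpos).symm
        calc X ^ n * (X * d⁄dX 𝕜 G) = X * (X ^ n * d⁄dX 𝕜 G) := by ring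
          _ = X * (C (n : 𝕜) * X ^ (n - 1) * G) := by rw [sub_eq_zero.mp key]
          _ = X ^ ((n - 1) + 1) * (C (n : 𝕜) * G) := by ring
          _ = X ^ n * (C (n : 𝕜) * G) := by rw [← hn1]
    · exact absurd key hU2.ne_zero
  have hX : (X : PowerSeries 𝕜) ^ n ≠ 0 := pow_ne_zero n X_ne_zero
  have hGeq := eq_monomial_of_X_mul_derivative_eq (mul_left_cancel₀ hX hXG)
  have hmon : monomial n (coeff n G) = C (coeff n G) * X ^ n := by
    rw [X_pow_eq, ← monomial_zero_eq_C_apply, monomial_mul_monomial, zero_add, mul_one]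
  have hGC : G = C (coeff n G) * X ^ n := hGeq.trans hmon
  refine ⟨coeff n G, ?_⟩
  calc M = G * ↑U := hMG
    _ = C (coeff n G) * X ^ n * ↑U := by rw [← hGC]
    _ = C (coeff n G) * Q := by rw [hQU, mul_assoc]

/-! ## §3 The solutions of `(1+T)·(Q·L′ − Q′·L) + a·Q·L = 0` -/

/-- **The formal ODE of the `λ`-descent has only the solutions `c·(1+T)^{−a}·Q`.** If `Q ≠ 0` and
`(1+T)·(Q·L′ − Q′·L) + a·Q·L = 0` in `𝕜⟦T⟧` (`char 𝕜 = 0`), then `L = c · (1+T)^{−a} · Q` for some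
`c ∈ 𝕜`: with `M := (1+T)^a·L` one gets `(1+T)·(Q·M′ − Q′·M) = (1+T)^a·((1+T)(QL′ − Q′L) + aQL) = 0`,
so Abel's identity applies. [cite: Washington1997, §7.1–7.2] [cite: Cassels1986, Ch. 4 Thm. 4.1] -/
theorem exists_eq_C_mul_binomialSeries_mul_of_ode {Q L : PowerSeries 𝕜} (a : 𝕜) (hQ : Q ≠ 0)
    (h : (1 + X) * (Q * d⁄dX 𝕜 L - d⁄dX 𝕜 Q * L) + C a * (Q * L) = 0) :
    ∃ c : 𝕜, L = C c * binomialSeries 𝕜 (-a) * Q := by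
  set B := binomialSeries 𝕜 a with hB
  have hBd : (1 + X) * d⁄dX 𝕜 B = C a * B := one_add_X_mul_derivative_binomialSeries a
  set M := B * L with hM
  have hW : Q * d⁄dX 𝕜 M = d⁄dX 𝕜 Q * M := by
    have h1X : IsUnit (1 + X : PowerSeries 𝕜) := by
      rw [isUnit_iff_constantCoeff, map_add, map_one, constantCoeff_X, add_zero]
      exact isUnit_one
    have hM' : d⁄dX 𝕜 M = d⁄dX 𝕜 B * L + B * d⁄dX 𝕜 L := by
      rw [hM, Derivation.leibniz, smul_eq_mul, smul_eq_mul]; ring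
    have key : (1 + X) * (Q * d⁄dX 𝕜 M - d⁄dX 𝕜 Q * M) = 0 := by
      calc (1 + X) * (Q * d⁄dX 𝕜 M - d⁄dX 𝕜 Q * M)
          = Q * L * ((1 + X) * d⁄dX 𝕜 B) + B * ((1 + X) * (Q * d⁄dX 𝕜 L - d⁄dX 𝕜 Q * L)) := by
            rw [hM', hM]; ring
        _ = B * ((1 + X) * (Q * d⁄dX 𝕜 L - d⁄dX 𝕜 Q * L) + C a * (Q * L)) := by rw [hBd]; ring
        _ = 0 := by rw [h, mul_zero]
    have := (h1X.mul_right_eq_zero).mp key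
    exact sub_eq_zero.mp this
  obtain ⟨c, hc⟩ := exists_eq_C_mul_of_wronskian hQ hW
  refine ⟨c, ?_⟩
  calc L = binomialSeries 𝕜 (-a) * (B * L) := by
          rw [← mul_assoc, mul_comm (binomialSeries 𝕜 (-a)), hB,
            binomialSeries_mul_binomialSeries_neg, one_mul]
    _ = binomialSeries 𝕜 (-a) * (C c * Q) := by rw [← hM, hc]
    _ = C c * binomialSeries 𝕜 (-a) * Q := by ring

end Summit.BirchSwinnertonDyer.BirchSwinnertonDyer.Theorems.KatzLineDescent

end
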